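import Summits.FinalStateConjecture.FinalStateConjecture.Theorems.BartnikGapSettlingBondiBartnikRigiditySlabCauchyRigidityDefs
import Literature.Geometry.Lorentzian.CauchyHypersurfaceCausalProofs
import Literature.Geometry.Lorentzian.CausalCurveLift
import Literature.Geometry.Lorentzian.CommonDevelopmentEmbedding
import HarnessLib

/-!
# F1' `stub_slabCauchyRigidity'`, step (e): placement of an embedded sub-development inside the
# faithful future domain of dependence (`SubdevelopmentFuturePlacement`) — line
# `direct-method-on-the-cone`, crux `BondiBartnikRigidity` (stmt-FinalStateConjecture-10807);
# module 3 of the landing of the conditional proof of F1'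

Route statement (E) `F1Route.SubdevelopmentFuturePlacement` of `…SlabCauchyRigidityDefs.lean`, PROVED
(`stub_subdevelopmentFuturePlacement`, registered bookkeeping sub-goal of the line):

* `exists_mem_of_isPastEndless_of_mem_chronologicalFuture` — **one-sided form of O'Neill's
  Lemma 14.29**: a PAST-endless future causal curve through a point of `I⁺(S)`, `S` a Cauchy
  hypersurface, meets `S` at or before that point (the tree's
  `IsCauchyHypersurface.false_of_isEndlessCausalCurve_of_mem_chronologicalFuture`, whose proof only
  uses the past half of the curve; adapted verbatim, stated with explicit arguments in this file's
  namespace rather than as a dot-notation extension of the Literature structure);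
* `subdevelopmentFuturePlacement_holds : SubdevelopmentFuturePlacement` — if a Cauchy development
  `𝒦` embeds isometrically, openly and future-preservingly into a spacetime `𝒮` by `χ`, then
  `χ(I⁺(ι N)) ⊆ D⁺_𝒮(χ(ι N))` for the FAITHFUL future domain of dependence `futureDomain` of the
  line's vocabulary: the maximal piece inside the open set `χ(𝒦)` of a past-endless causal curve of
  `𝒮` lifts to a past-endless causal curve of `𝒦` (`IsFutureCausalCurveOn.invFun_comp`,
  `not_hasPastEndpoint_connectedComponentIn`) and the one-sided lemma applies in `𝒦`.

References: O'Neill 1983, Ch. 14, Lemma 14.29 [ONeillSemiRiemannian1983]; Hawking–Ellis 1973, §6.5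
[HawkingEllis1973CUP]; Sbierski 2016, §3.3 [Sbierski2016AHP].  No definitions, no named facts.
-/

noncomputable section

-- D-0017: single-problem summit, `Summit.<S>.<S>.…` by design (cf. lakefile `weak.linter.dupNamespace`).
set_option linter.dupNamespace false

open Set Filter Function Topology TopologicalSpace Bundle
open Literature.Geometry.Lorentzian
open scoped Manifold ContDiff Topology

namespace Summit.FinalStateConjecture.FinalStateConjecture.Theorems.BondiBartnikRigidity.DirectMethod

namespace F1Route

section OneSided

open LorentzianMetric

variable {E : Type*} [NormedAddCommGroup E] [NormedSpace ℝ E] {H : Type*} [TopologicalSpace H]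
  {I : ModelWithCorners ℝ E H} {n : ℕ∞ω} {M : Type*} [TopologicalSpace M] [ChartedSpace H M]
  [IsManifold I ∞ M] {g : LorentzianMetric I n M} {τ : TimeOrientation g}

-- adapted from `Literature/Geometry/Lorentzian/CauchyHypersurfaceCausalProofs.lean`
-- (`IsCauchyHypersurface.false_of_isEndlessCausalCurve_of_mem_chronologicalFuture`: the endless
-- curve is replaced by a past-endless one and the conclusion made positive)
/-- **One-sided form of O'Neill's Lemma 14.29**: on a Hausdorff, second countable,
finite-dimensional manifold without boundary with a `Cⁿ` (`n ≥ 2`) time-oriented Lorentzian metric,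
a future causal curve `γ` on an interval `s` WITHOUT PAST ENDPOINT, through a point `γ t₀ ∈ I⁺(S)`
of the chronological future of a Cauchy hypersurface `S`, meets `S` at some parameter `t ≤ t₀`.
Proof (O'Neill's): otherwise the past half of `γ` lies in `I⁺(S)`; the avoidance lemma
(`exists_isPastEndless_timelike_shadow`) gives a past-endless timelike curve in `I⁺(S)` ending above
`γ t₀`, whose endless future extension stays in `I⁺(S)` and must meet `S` — against achronality.
[cite: ONeillSemiRiemannian1983, Ch. 14, Lemma 29 (p. 415)] -/
theorem exists_mem_of_isPastEndless_of_mem_chronologicalFuture [T2Space M]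
    [SecondCountableTopology M] [BoundarylessManifold I M] [FiniteDimensional ℝ E] (hn : 2 ≤ n)
    {S : Set M} (hS : g.IsCauchyHypersurface τ S) {γ : ℝ → M} {s : Set ℝ} (hs : s.OrdConnected)
    (hγc : g.IsFutureCausalCurveOn τ γ s) (hend : IsPastEndless γ s) {t₀ : ℝ} (ht₀ : t₀ ∈ s)
    (hI : γ t₀ ∈ g.chronologicalFuture τ S) : ∃ t ∈ s, t ≤ t₀ ∧ γ t ∈ S := by
  by_contra hmiss
  push Not at hmiss
  have hn1 : (1 : ℕ∞ω) ≤ n := le_trans one_le_two hn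
  have hA : g.IsAchronal τ S := IsCauchyHypersurface.isAchronal_holds hn hS
  have hdisj : Disjoint (g.chronologicalFuture τ S) S := (isAchronal_iff_disjoint S).mp hA
  have hdisj' : Disjoint (g.chronologicalFuture τ S) (g.chronologicalPast τ S) := by
    rw [Set.disjoint_left]
    rintro p hpF ⟨x, hx, μ, a, b, hab, hμ, hμa, hμb⟩
    have hx' : x ∈ g.chronologicalFuture τ {p} :=
      ⟨p, rfl, fun t ↦ μ (a + b - t), a, b, hab,
        isFutureTimelikeCurveOn_reverse_reverse_iff.mp hμ.reverseParam, by simp [hμb],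
        by simp [hμa]⟩
    exact Set.disjoint_left.mp hdisj (mem_chronologicalFuture_trans hpF hx') hx
  -- Step 1: the past half `J` of the curve lies in `I⁺(S)`
  set J : Set ℝ := s ∩ Iic t₀ with hJ_def
  have hJ : J.OrdConnected := hs.inter ordConnected_Iic
  have ht₀J : t₀ ∈ J := ⟨ht₀, mem_Iic.mpr le_rfl⟩
  have hαJ : g.IsFutureCausalCurveOn τ γ J := hγc.mono inter_subset_left
  have hmissJ : ∀ t ∈ J, γ t ∉ S := fun t ht ↦ hmiss t ht.1 ht.2
  have hIJ : ∀ t ∈ J, γ t ∈ g.chronologicalFuture τ S := by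
    have himg : γ '' J ⊆ g.chronologicalFuture τ S ∪ g.chronologicalPast τ S := by
      rintro _ ⟨t, ht, rfl⟩
      exact hS.mem_chronologicalFuture_union_chronologicalPast hn (hmissJ t ht)
    have hconn : IsPreconnected (γ '' J) :=
      hJ.isPreconnected.image γ fun t ht ↦ (hαJ.continuousAt ht).continuousWithinAt
    rcases hconn.subset_or_subset (isOpen_chronologicalFuture_of_boundaryless g τ S)
      (isOpen_chronologicalPast_of_boundaryless g τ S) hdisj' himg with h | h
    · exact fun t ht ↦ h (mem_image_of_mem γ ht)
    · exact absurd (h (mem_image_of_mem γ ht₀J)) (Set.disjoint_left.mp hdisj' hI)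
  -- Step 2: `γ|_J` is past endless; a non-convergent decreasing sequence of parameters
  have hendJ : IsPastEndless γ J := by
    refine ⟨⟨t₀, ht₀J⟩, fun P hP ↦ hend.2 P ?_⟩
    rwa [hasPastEndpoint_congr_set ht₀J ht₀ (fun t ht ↦ ⟨fun h ↦ h.1, fun h ↦ ⟨h, ht⟩⟩)] at hP
  obtain ⟨t, htJ, hanti, ht0, -, hnc⟩ := exists_antitone_seq_not_tendsto hJ hendJ ht₀J
  -- Step 3: a point `p₀ ≫ γ t₀`, hence `p₀ ≫ γ (t 0)` by push-up
  obtain ⟨μ, ε, hε, hμ0, hμ⟩ := g.exists_isFutureTimelikeCurveOn_Ioo_of_isInteriorPoint τ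
    (BoundarylessManifold.isInteriorPoint (I := I) (x := γ t₀))
  have hp₀ : μ (ε / 2) ∈ g.chronologicalFuture τ {γ t₀} :=
    ⟨γ t₀, rfl, μ, 0, ε / 2, by positivity,
      hμ.mono (Icc_subset_Ioo (by linarith) (by linarith)), hμ0, rfl⟩
  have hp₀' : μ (ε / 2) ∈ g.chronologicalFuture τ {γ (t 0)} := by
    refine mem_chronologicalFuture_of_mem_causalFuture hn1 ?_ hp₀
    rcases ht0.eq_or_lt with h | h
    · rw [h]; exact subset_causalFuture g τ _ (mem_singleton _)
    · exact Or.inr ⟨γ (t 0), rfl, γ, t 0, t₀, h, hαJ.mono (hJ.out (htJ 0) ht₀J), rfl, rfl⟩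
  -- Step 4: the shadowing past-endless timelike curve, inside `I⁺(S)`
  obtain ⟨β, D, hD, h0D, hD0, hβ, hβend, hβ0, hβI⟩ :=
    exists_isPastEndless_timelike_shadow hn1 hJ hαJ htJ hanti hnc hp₀'
  have hβS : ∀ u ∈ D, β u ∈ g.chronologicalFuture τ S := by
    intro u hu
    obtain ⟨j, hj⟩ := hβI u hu
    exact mem_chronologicalFuture_trans (hIJ _ (htJ j)) hj
  -- Step 5: extend to the future; the endless timelike curve stays in `I⁺(S)` yet meets `S`
  obtain ⟨Δ, D', hΔ, -, hΔD, hΔI⟩ :=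
    exists_isEndlessTimelikeCurve_extends_future hn hD h0D hD0 hβ hβend
  have hp₀S : μ (ε / 2) ∈ g.chronologicalFuture τ S := mem_chronologicalFuture_trans (hIJ t₀ ht₀J) hp₀
  have hΔS : ∀ t ∈ D', Δ t ∈ g.chronologicalFuture τ S := by
    intro t ht
    by_cases htD : t ∈ D
    · rw [hΔD t htD]; exact hβS t htD
    · have := hΔI t ht htD
      rw [hβ0] at this
      exact mem_chronologicalFuture_trans hp₀S this
  obtain ⟨t₁, ⟨ht₁, ht₁S⟩, -⟩ := hS Δ D' hΔ
  exact Set.disjoint_left.mp hdisj (hΔS t₁ ht₁) ht₁S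

end OneSided

/-- **(E) holds**: `χ(I⁺(ι N)) ⊆ D⁺_𝒮(χ(ι N))` (faithful future domain of dependence). Given a
past-endless causal curve `γ` of `𝒮` through `χ y`, `y ∈ I⁺_𝒦(ι N)`, its maximal piece `γ|_J`
inside the open set `χ(𝒦)` lifts along the injective local isometry `χ` to a future causal curve
`δ = χ⁻¹ ∘ γ` of `𝒦` (`IsFutureCausalCurveOn.invFun_comp`), past-endless in `𝒦` (an endpoint
`e` would make `χ e ∈ χ(𝒦)` a past endpoint of `γ|_J`, `not_hasPastEndpoint_connectedComponentIn`);
by the one-sided Lemma 14.29 in `𝒦`, `δ` meets `ι N` at some `t ≤ t₀`, so `γ t ∈ χ(ι N)`.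
[cite: ONeillSemiRiemannian1983, Ch. 14, Lemma 29 (p. 415)] [cite: Sbierski2016AHP, §3.3] -/
theorem subdevelopmentFuturePlacement_holds : SubdevelopmentFuturePlacement := by
  intro N _ _ _ _ D₁ 𝒦 𝒮 χ hχs hχo hχi hχt
  rintro _ ⟨y, hy, rfl⟩ γ s hs hγ hend t₀ ht₀ hγt₀
  classical
  have hn2 : (2 : ℕ∞ω) ≤ ((⊤ : ℕ∞) : ℕ∞ω) := WithTop.coe_le_coe.mpr le_top
  set O : Set 𝒮.carrier := range χ with hO_def
  have hO : IsOpen O := hχo.isOpen_range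
  have hγO : γ t₀ ∈ O := ⟨y, hγt₀.symm⟩
  -- the maximal piece of `γ` inside `O` through `t₀`
  set J : Set ℝ := connectedComponentIn (s ∩ γ ⁻¹' O) t₀ with hJ_def
  have ht₀J : t₀ ∈ J := mem_connectedComponentIn ⟨ht₀, hγO⟩
  have hJsub : J ⊆ s ∩ γ ⁻¹' O := connectedComponentIn_subset _ _
  have hJord : J.OrdConnected :=
    isPreconnected_iff_ordConnected.1 isPreconnected_connectedComponentIn
  -- the lift `δ = χ⁻¹ ∘ γ` on `J`
  set δ : ℝ → 𝒦.carrier := Function.invFun χ ∘ γ with hδ_def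
  have hχδ : ∀ t ∈ J, χ (δ t) = γ t := fun t ht ↦ Function.invFun_eq (hJsub ht).2
  have hloc : IsLocalDiffeomorph (𝓡 4) (𝓡 4) ∞ χ :=
    LorentzianMetric.isLocalDiffeomorph_of_isIsometricImmersion hχi
  have hδc : 𝒦.metric.IsFutureCausalCurveOn 𝒦.timeOrientation δ J :=
    LorentzianMetric.IsFutureCausalCurveOn.invFun_comp hχi hχt hχo.injective hloc
      (hγ.mono fun t ht ↦ (hJsub ht).1) fun t ht ↦ (hJsub ht).2
  -- `δ|_J` is past endless in `𝒦`
  have hδend : IsPastEndless δ J := by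
    refine ⟨⟨t₀, ht₀J⟩, fun e he ↦ ?_⟩
    have hγe : HasPastEndpoint γ J (χ e) := by
      have h1 : HasPastEndpoint (χ ∘ δ) J (χ e) := (hχs.continuous.tendsto e).comp he
      exact h1.congr fun t ↦ hχδ t t.2
    exact not_hasPastEndpoint_connectedComponentIn hs (fun t ht ↦ hγ.continuousAt ht) hend hO ht₀
      hγO ⟨e, rfl⟩ hγe
  -- `δ t₀ = y ∈ I⁺(ι N)`
  have hδt₀ : δ t₀ = y := hχo.injective ((hχδ t₀ ht₀J).trans hγt₀)
  have hI : δ t₀ ∈ 𝒦.metric.chronologicalFuture 𝒦.timeOrientation (range 𝒦.embed) := by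
    rw [hδt₀]; exact hy
  obtain ⟨t, htJ, htt₀, htS⟩ :=
    exists_mem_of_isPastEndless_of_mem_chronologicalFuture hn2 𝒦.isCauchyHypersurface hJord hδc
      hδend ht₀J hI
  exact ⟨t, (hJsub htJ).1, htt₀, δ t, htS, hχδ t htJ⟩

end F1Route

open F1Route in
/-- **Registered bookkeeping sub-goal `stub_subdevelopmentFuturePlacement` of the line** (brick of
the landing of F1' `stub_slabCauchyRigidity'`): route statement (E) `SubdevelopmentFuturePlacement`
holds — an embedded Cauchy development maps the chronological future of its Cauchy hypersurface into
the faithful future domain of dependence of the image hypersurface.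
[cite: ONeillSemiRiemannian1983, Ch. 14, Lemma 29 (p. 415)] -/
theorem stub_subdevelopmentFuturePlacement : F1Route.SubdevelopmentFuturePlacement :=
  subdevelopmentFuturePlacement_holds

end Summit.FinalStateConjecture.FinalStateConjecture.Theorems.BondiBartnikRigidity.DirectMethod

end
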